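import Summits.QuantumFields.YangMills.Theorems.BalabanUVNodesClustersCore
import Summits.QuantumFields.YangMills.Theorems.BalabanUVNodesN27BudgetRedundant

/-!
# BalabanUVNodes ∕ N27 = binder B5 AT THE RECORD (module XII of seat `dag-n27-a`; the node's «AT-RECORD» module per the ONE WRITER's
# word (W2)) — the N27 faces over the ROUTE MODULE OF RECORD `BalabanUVNodesClustersCore` (`YMDAG.UVSplit`, p416552) BY NAME: readings and
# monotonicity of `Spine` ∕ `SpineMatching` ∕ `SpineRates` ∕ the K5 stubs in the parameters `Rec` ∕ `SRec` ∕ `Inputs`; the dagwriter's per-string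
# `SpineDatum`, cluster K5 «SpineMatching» and the merged child «Spine» (= B5 at every record pair) from the K5 stub signatures `S_N27x` ·
# `S_N20` · `S_N21` · `S_N19` with `S_U4`'s budget half `∀ K, W K + Wsh K < 1` NOT ASKED (and from the ∃δ-edge with U4′ not asked at all);
# origin reconciliation; and the record-level faithfulness «Spine = unguarded K5»
# (cell `pub-ymgap`, HUMAN RULING D-0062 Track A, seat `pub-ymgap-dag-n27-a` g4; `--supports stmt-QuantumFields-19182`, count-neutral)

WHY.  The route module of record types N27's children over three PARAMETERS — the record predicate `Rec : RecordPred N`, the spine-carrier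
predicate `SRec : SpineRecordPred N`, K4's conclusion `Inputs : InputsPred N` — and states cluster K5 as
`SpineMatching Rec Inputs` («under the pins, for all small-coupling tuned runs and every loop string, the in-edges of N19 IMPLY
`SpineDatum D g₀ os`»), the merged spine child as `Spine Rec := ∀ F D w, Rec F D w → T4ApexHybrid.HybridNE7Under D END` (= binder B5
at the record), with the stub `S_U4 SRec := ∀ …, SRec … S → (∀ K, S.W K + S.Wsh K < 1) ∧ Summable S.δ`.  Files IX–XI of this seat
certified AT THE DATUM that the budget clause is idle (it holds from some origin on by N20's `RelWeightBound.summable` and N21's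
`ShellWeightBound.summable`, `T4MatchingClosure.eventually_budget_lt_one`, everything else being shifted there).  THIS FILE says the same
IN THE ROUTE MODULE'S OWN CURRENCY, over its parameters, so that the ONE WRITER's rev-1 `SRec₅` ∕ K5 stubs can cite it by name:
`SpineDatum` already quantifies its offset `∃ K₀`, hence absorbs the shift; `S_U4`'s first conjunct is never needed for
`SpineMatching`, `Spine`, `UVD59`.

WHAT IS KERNEL-CHECKED ([bookkeeping] ∕ [folklore]; 0 `def`, 0 `sorry`; every step a tree theorem BY NAME).
* §0 (the (W2) «AT-RECORD» readings) `spine_iff` (`Iff.rfl`) · `spine_antitone` (= the REFINEMENT-GENERIC closer of an UNDISCHARGED composite node: B5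
  at a coarser record predicate ⇒ B5 at every refinement; no stage instance has a producer today — N19 ∕ N20 ∕ N21 ∕ N27x are 0∕1 at every record) ·
  `spineMatching_antitone` · `spineRates_mono` · `s_N19_antitone` · `s_N20_antitone` · `s_N21_antitone` · `s_U4_antitone` · `s_N27x_mono` — NOTE THE
  OPPOSITE VARIANCE IN `SRec`: the estimates N19 ∕ N20 ∕ N21 ∕ U4′ are antitone in the spine-carrier predicate, the existence stub N27x is MONOTONE in
  it, so `SRec` is pinned from both sides (a typing fact for the `SRec` definer: it must be NODE 00's exact carriers of record, neither a superset
  nor a subset class).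
* §1 (per string, at a datum `D : Datum F N`) `spineDatum_of_tail` — `0 < l₀`, `0 < vol`, N20 `RelWeightBound`, N21 `ShellWeightBound`,
  N19's `Spine.NE7.Core` on the shell-free cores, `Summable δ`, the E1∕E2 dictionary from cutoff `K₀` on ⇒ `YMDAG.UVSplit.SpineDatum D g₀ os`
  (witness offset `K₀ + K₁`, families shifted by `relWeightBound_shift` ∕ `shellWeightBound_shift` ∕ `core_shift` ∕ `Summable.comp_injective`,
  budget from `eventually_budget_lt_one`, dictionary re-associated); `spineDatum_iff_tail` — `SpineDatum D g₀ os` is EQUIVALENT to its own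
  body with the conjunct `∀ K, W K + Wsh K < 1` dropped.
* §1′ `relWeightBound_reorigin` ∕ `shellWeightBound_reorigin` ∕ `coreSummable_reorigin` ∕ **`spineDatum_of_origins`** — ORIGIN RECONCILIATION:
  N20 delivered from relative origin `K₁`, N21 from `K₂`, N19's ∃δ-edge from `K₃`, the dictionary from `K₀` ⇒ `SpineDatum D g₀ os` (every structure
  tolerates any later origin; dag-ref-B READ-225's consumer pin «ONE reconciled origin» needs no clause in a spine record).
* §2 (record level, for EVERY `Rec`, `SRec`, `Inputs`) `spineMatching_of_stubs_tail` — `S_N27x Rec SRec`, `S_N20 SRec`, `S_N21 SRec`,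
  `S_N19 SRec Inputs` and ONLY the summability half of U4′ (`∀ …, SRec … S → Summable S.δ`) ⇒ `SpineMatching Rec Inputs` (the route
  module's `SpineMatching_of` with `S_U4` weakened); `spine_of_stubs_tail` — the same + K4's hook `SpineRates Rec Inputs` ⇒ `Spine Rec`
  (B5 AT THE RECORD), proved directly per string by file IX's `stringHybridNE7_of_spineNodes_tail` (`ForSmallCouplings.and` at the smaller
  thresholds, modus ponens per string; independent of the joins part `BalabanUVNodesClusters`).
* §2′ `spineMatching_of_coreEdge` ∕ `spine_of_coreEdge` — the same two joins with N19 as the ∃δ-EDGE «`SRec … S → Inputs … → ∃ δ,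
  Spine.NE7.Core … δ ∧ Summable δ`» (δ NOT read from `S.δ`; U4′ not asked AT ALL) = the plan's rev-1 K5 design «N27x · N20 · N21 · N19′, U4′
  retired» ([YMPLAN-G62-WORD-N19-JUNCTION] (d)) typed over today's decls — the shape every landed N19 knit produces.
* §3 `spine_iff_spineMatching_true` — FAITHFULNESS AT THE RECORD: `Spine Rec ↔ SpineMatching Rec (fun _ _ _ _ => True)`; the merged child
  «Spine» IS cluster K5 with K4's conclusion set to `True` (R420's unguarded K5), nothing smuggled, nothing lost (file X's
  `hybridNE7Under_iff_spineNodes_tail` + §1; `T4ContinuumYM4Torus.underHypotheses_iff` definitional).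

HONEST FRAMING.  COMPOSITE-node bookkeeping over PARAMETERS: no record predicate, no spine carrier, no estimate of Bałaban's is
instantiated or asserted; NE7 ∕ NE7b ∕ NE7c are hypothesis shapes (none printed for the d = 4 procedure, none proved); (B) and END are
antecedents, used, never refuted; NO node is discharged; typed 28∕28, the discharged count is not touched by this file; one fixed finite
four-torus programme — NOT ℝ⁴, NOT infinite volume, NOT OS axioms, NOT a mass gap, NOT Clay.  Restate-immune: neither the route file
`Theses/BalabanUVNodes.lean` nor g0's `BalabanUVNodesSpineGivenEndpointN27` is imported.  No decl below carries a cite tag.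
-/

open Finset MeasureTheory

namespace Summit.QuantumFields.YangMills.Theorems.BalabanUVNodesN27SpineRecord

open Literature.MathematicalPhysics.QuantumFieldTheory.Balaban1983to89
open Literature.MathematicalPhysics.QuantumFieldTheory.Balaban1983to89.T4Continuum
open T4WeightBudget (RelWeightBound)
open T4IndicatorShell (ShellWeightBound)
open T4MatchingAssembly (HybridNE7 StringHybridNE7)
open T4MatchingClosure (eventually_budget_lt_one)
open T4MatchingClosureSocket (relWeightBound_shift shellWeightBound_shift)
open T4ContinuumYM4Torus (ForSmallCouplings)
open Summit.QuantumFields.BalabanUV.T4Continuum.Spine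
open YMDAG.UVSplit

/-! ## §0 The (W2) readings: `Spine`, `SpineMatching`, `SpineRates` and the K5 stubs UNFOLDED (`Iff.rfl`) and their variance in the parameters -/

section Readings

variable {N : ℕ} [NeZero N]

/-- **What `Spine Rec` says** (`Iff.rfl`): at every record pair `(D, w)` of `Rec`, binder B5 — `T4ApexHybrid.HybridNE7Under D END`, i.e.
`(B) → END → ForSmallCouplings D (fun g₀ => StringwiseHybridNE7 (D.scheme g₀))`. [bookkeeping] -/
theorem spine_iff (Rec : RecordPred N) :
    Spine Rec ↔ ∀ (F : T4Family) (D : Datum F N) (w : DagBinding.WorldP), Rec F D w →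
      T4ApexHybrid.HybridNE7Under D (DagBinding.EndpointExistence D.C.toB12) :=
  Iff.rfl

/-- **`Spine` is ANTITONE in the record predicate** — THE REFINEMENT-GENERIC CLOSER of the composite node: B5 at a record predicate `Rec` gives B5 at
every `Rec'` refining it (every later NODE 00 stage, the route's re-letterings).  N27 being undischarged, the coarse-stage premise has no producer today.
[bookkeeping] -/
theorem spine_antitone {Rec Rec' : RecordPred N}
    (hle : ∀ (F : T4Family) (D : Datum F N) (w : DagBinding.WorldP), Rec' F D w → Rec F D w) (h : Spine Rec) : Spine Rec' :=
  fun F D w hR => h F D w (hle F D w hR)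

/-- `SpineMatching` is antitone in `Rec` and antitone in `Inputs` (STRONGER in-edges keep K5). [bookkeeping] -/
theorem spineMatching_antitone {Rec Rec' : RecordPred N} {Inputs Inputs' : InputsPred N}
    (hle : ∀ (F : T4Family) (D : Datum F N) (w : DagBinding.WorldP), Rec' F D w → Rec F D w)
    (hin : ∀ (F : T4Family) (D : Datum F N) (g₀ : ℕ → ℝ) (os : List (ULoop F)), Inputs' F D g₀ os → Inputs F D g₀ os)
    (h : SpineMatching Rec Inputs) : SpineMatching Rec' Inputs' :=
  fun F D w hR hB hEnd => (h F D w (hle F D w hR) hB hEnd).mono fun g₀ hg os hin' => hg os (hin F D g₀ os hin')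

/-- `SpineRates` (K4's hook) is antitone in `Rec` and MONOTONE in `Inputs` (weaker conclusions are easier). [bookkeeping] -/
theorem spineRates_mono {Rec Rec' : RecordPred N} {Inputs Inputs' : InputsPred N}
    (hle : ∀ (F : T4Family) (D : Datum F N) (w : DagBinding.WorldP), Rec' F D w → Rec F D w)
    (hin : ∀ (F : T4Family) (D : Datum F N) (g₀ : ℕ → ℝ) (os : List (ULoop F)), Inputs F D g₀ os → Inputs' F D g₀ os)
    (h : SpineRates Rec Inputs) : SpineRates Rec' Inputs' :=
  fun F D w hR hB hEnd => (h F D w (hle F D w hR) hB hEnd).mono fun g₀ hg os => hin F D g₀ os (hg os)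

/-- `S_N19` is antitone in `SRec` and in `Inputs`. [bookkeeping] -/
theorem s_N19_antitone {SRec SRec' : SpineRecordPred N} {Inputs Inputs' : InputsPred N}
    (hS : ∀ (F : T4Family) (D : Datum F N) (g₀ : ℕ → ℝ) (os : List (ULoop F)) (S : SpineCarriers), SRec' F D g₀ os S → SRec F D g₀ os S)
    (hin : ∀ (F : T4Family) (D : Datum F N) (g₀ : ℕ → ℝ) (os : List (ULoop F)), Inputs' F D g₀ os → Inputs F D g₀ os)
    (h : S_N19 SRec Inputs) : S_N19 SRec' Inputs' :=
  fun F D g₀ os S hS' hin' => h F D g₀ os S (hS F D g₀ os S hS') (hin F D g₀ os hin')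

/-- `S_N20` (NE7b at the carriers) is antitone in `SRec`. [bookkeeping] -/
theorem s_N20_antitone {SRec SRec' : SpineRecordPred N}
    (hS : ∀ (F : T4Family) (D : Datum F N) (g₀ : ℕ → ℝ) (os : List (ULoop F)) (S : SpineCarriers), SRec' F D g₀ os S → SRec F D g₀ os S)
    (h : S_N20 SRec) : S_N20 SRec' :=
  fun F D g₀ os S hS' => h F D g₀ os S (hS F D g₀ os S hS')

/-- `S_N21` (NE7c at the carriers) is antitone in `SRec`. [bookkeeping] -/
theorem s_N21_antitone {SRec SRec' : SpineRecordPred N}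
    (hS : ∀ (F : T4Family) (D : Datum F N) (g₀ : ℕ → ℝ) (os : List (ULoop F)) (S : SpineCarriers), SRec' F D g₀ os S → SRec F D g₀ os S)
    (h : S_N21 SRec) : S_N21 SRec' :=
  fun F D g₀ os S hS' => h F D g₀ os S (hS F D g₀ os S hS')

/-- `S_U4` is antitone in `SRec`. [bookkeeping] -/
theorem s_U4_antitone {SRec SRec' : SpineRecordPred N}
    (hS : ∀ (F : T4Family) (D : Datum F N) (g₀ : ℕ → ℝ) (os : List (ULoop F)) (S : SpineCarriers), SRec' F D g₀ os S → SRec F D g₀ os S)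
    (h : S_U4 SRec) : S_U4 SRec' :=
  fun F D g₀ os S hS' => h F D g₀ os S (hS F D g₀ os S hS')

/-- **`S_N27x` is antitone in `Rec` but MONOTONE in `SRec`** — the existence stub wants the spine-carrier predicate WEAK while N19 ∕ N20 ∕ N21 ∕ U4′
want it STRONG: `SRec` is pinned from both sides. [bookkeeping] -/
theorem s_N27x_mono {Rec Rec' : RecordPred N} {SRec SRec' : SpineRecordPred N}
    (hle : ∀ (F : T4Family) (D : Datum F N) (w : DagBinding.WorldP), Rec' F D w → Rec F D w)
    (hS : ∀ (F : T4Family) (D : Datum F N) (g₀ : ℕ → ℝ) (os : List (ULoop F)) (S : SpineCarriers), SRec F D g₀ os S → SRec' F D g₀ os S)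
    (h : S_N27x Rec SRec) : S_N27x Rec' SRec' :=
  fun F D w hR hB hEnd => (h F D w (hle F D w hR) hB hEnd).mono fun g₀ hg os => by
    obtain ⟨S, hSS, hl₀, hvol, hZA, hZB⟩ := hg os
    exact ⟨S, hS F D g₀ os S hSS, hl₀, hvol, hZA, hZB⟩

end Readings

/-! ## §1 The route module's per-string `SpineDatum`, budget conjunct not asked -/

section PerString

variable {F : T4Family} {N : ℕ} [NeZero N]

/-- **`SpineDatum` WITHOUT THE BUDGET CLAUSE.**  At a datum `D`, a tuned bare sequence `g₀` and a loop string `os`: term-class carriers with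
`0 < l₀`, `0 < vol` carrying N20 (`RelWeightBound`), N21 (`ShellWeightBound`), N19's `Spine.NE7.Core` on the shell-free cores with a summable
`δ`, and the E1∕E2 dictionary against `T4GenFunBounds.schemeZ (D.scheme g₀) os (K₀ + K)` give the route module's `YMDAG.UVSplit.SpineDatum D g₀ os`
— whose extra conjunct `∀ K, W K + Wsh K < 1` holds from some origin `K₁` on by the two weight structures' OWN `summable` fields
(`T4MatchingClosure.eventually_budget_lt_one`); the witness is the `K₁`-shifted carrier family at offset `K₀ + K₁` (`relWeightBound_shift`,
`shellWeightBound_shift`, `core_shift`, `Summable.comp_injective`, the dictionary re-associated).  `SpineDatum`'s `∃ K₀` absorbs the shift.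
[bookkeeping] [folklore] -/
theorem spineDatum_of_tail (D : Datum F N) (g₀ : ℕ → ℝ) (os : List (ULoop F))
    {ι : Type} [DecidableEq ι] {l₀ vol : ℝ} (K₀ : ℕ) {T : ℕ → Finset ι} {A B shA shB : ℕ → ℝ → ι → ℝ}
    {Bad : ℕ → ℝ → Finset ι} {W Wsh δ : ℕ → ℝ}
    (hl₀ : 0 < l₀) (hvol : 0 < vol) (h20 : RelWeightBound l₀ T A B Bad W) (h21 : ShellWeightBound l₀ T A B shA shB Wsh)
    (h19 : NE7.Core l₀ vol T Bad (fun K t τ => A K t τ - shA K t τ) (fun K t τ => B K t τ - shB K t τ) δ) (hδ : Summable δ)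
    (hE1 : ∀ (K : ℕ) (t : ℝ), |t| ≤ l₀ → T4GenFunBounds.schemeZ (D.scheme g₀) os (K₀ + K) t = ∑ τ ∈ T K, A K t τ)
    (hE2 : ∀ (K : ℕ) (t : ℝ), |t| ≤ l₀ → T4GenFunBounds.schemeZ (D.scheme g₀) os (K₀ + K + 1) t = ∑ τ ∈ T K, B K t τ) :
    SpineDatum D g₀ os := by
  obtain ⟨K₁, hK₁⟩ := eventually_budget_lt_one h20.summable h21.summable
  refine ⟨ι, ‹_›, l₀, vol, K₀ + K₁, fun K => T (K₁ + K), fun K => A (K₁ + K), fun K => B (K₁ + K), fun K => shA (K₁ + K),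
    fun K => shB (K₁ + K), fun K => Bad (K₁ + K), fun K => W (K₁ + K), fun K => Wsh (K₁ + K), fun K => δ (K₁ + K), hl₀, hvol,
    relWeightBound_shift K₁ h20, shellWeightBound_shift K₁ h21, core_shift K₁ h19,
    fun K => hK₁ (K₁ + K) (Nat.le_add_right K₁ K), hδ.comp_injective (add_right_injective K₁),
    fun K t ht => ?_, fun K t ht => ?_⟩
  · have e : K₀ + K₁ + K = K₀ + (K₁ + K) := add_assoc _ _ _
    rw [e]
    exact hE1 (K₁ + K) t ht
  · have e : K₀ + K₁ + K = K₀ + (K₁ + K) := add_assoc _ _ _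
    rw [e]
    exact hE2 (K₁ + K) t ht

/-- **THE ROUTE MODULE'S `SpineDatum` IS EQUIVALENT TO ITS BODY WITHOUT THE BUDGET CONJUNCT** (`∀ K, W K + Wsh K < 1` dropped; forward:
forget it; backward: `spineDatum_of_tail`).  K5 typing consequence in the module's own currency: a rev-1 spine-carrier predicate ∕ K5 stub
set needs no «budget < 1» clause. [bookkeeping] [folklore] -/
theorem spineDatum_iff_tail (D : Datum F N) (g₀ : ℕ → ℝ) (os : List (ULoop F)) :
    SpineDatum D g₀ os ↔
      ∃ (ι : Type) (_ : DecidableEq ι) (l₀ vol : ℝ) (K₀ : ℕ) (T : ℕ → Finset ι) (A B shA shB : ℕ → ℝ → ι → ℝ)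
        (Bad : ℕ → ℝ → Finset ι) (W Wsh δ : ℕ → ℝ),
        0 < l₀ ∧ 0 < vol ∧
          RelWeightBound l₀ T A B Bad W ∧
          ShellWeightBound l₀ T A B shA shB Wsh ∧
          NE7.Core l₀ vol T Bad (fun K t τ => A K t τ - shA K t τ) (fun K t τ => B K t τ - shB K t τ) δ ∧
          Summable δ ∧
          (∀ K t, |t| ≤ l₀ → T4GenFunBounds.schemeZ (D.scheme g₀) os (K₀ + K) t = ∑ τ ∈ T K, A K t τ) ∧
          (∀ K t, |t| ≤ l₀ → T4GenFunBounds.schemeZ (D.scheme g₀) os (K₀ + K + 1) t = ∑ τ ∈ T K, B K t τ) := by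
  constructor
  · rintro ⟨ι, _, l₀, vol, K₀, T, A, B, shA, shB, Bad, W, Wsh, δ, hl₀, hvol, h20, h21, h19, -, hδ, hE1, hE2⟩
    exact ⟨ι, ‹_›, l₀, vol, K₀, T, A, B, shA, shB, Bad, W, Wsh, δ, hl₀, hvol, h20, h21, h19, hδ, hE1, hE2⟩
  · rintro ⟨ι, _, l₀, vol, K₀, T, A, B, shA, shB, Bad, W, Wsh, δ, hl₀, hvol, h20, h21, h19, hδ, hE1, hE2⟩
    exact spineDatum_of_tail D g₀ os K₀ hl₀ hvol h20 h21 h19 hδ hE1 hE2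

end PerString

/-! ## §1′ ORIGIN RECONCILIATION: the children delivered from DIFFERENT origins (N20 from `K₁`, N21 from `K₂`, N19's Core from `K₃`, the
dictionary from `K₀`) still give `SpineDatum` — every structure tolerates any later origin (dag-ref-B READ-225 consumer pin «ONE reconciled
origin; both thresholds tolerate any larger origin») -/

section Reorigin

variable {ι : Type} {l₀ vol : ℝ} {T : ℕ → Finset ι} {A B shA shB : ℕ → ℝ → ι → ℝ} {Bad : ℕ → ℝ → Finset ι} {W Wsh : ℕ → ℝ}

/-- N20's `RelWeightBound` delivered from origin `K₁` holds from every later origin `M ≥ K₁` (weights re-indexed; `relWeightBound_shift`).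
[bookkeeping] [folklore] -/
theorem relWeightBound_reorigin {K₁ M : ℕ} (hM : K₁ ≤ M)
    (h : RelWeightBound l₀ (fun K => T (K₁ + K)) (fun K => A (K₁ + K)) (fun K => B (K₁ + K)) (fun K => Bad (K₁ + K)) W) :
    ∃ W' : ℕ → ℝ, RelWeightBound l₀ (fun K => T (M + K)) (fun K => A (M + K)) (fun K => B (M + K)) (fun K => Bad (M + K)) W' := by
  obtain ⟨d, rfl⟩ := Nat.exists_eq_add_of_le hM
  exact ⟨fun K => W (d + K), by simpa only [add_assoc] using relWeightBound_shift d h⟩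

/-- N21's `ShellWeightBound` delivered from origin `K₂` holds from every later origin `M ≥ K₂` (`shellWeightBound_shift`). [bookkeeping] [folklore] -/
theorem shellWeightBound_reorigin {K₂ M : ℕ} (hM : K₂ ≤ M)
    (h : ShellWeightBound l₀ (fun K => T (K₂ + K)) (fun K => A (K₂ + K)) (fun K => B (K₂ + K)) (fun K => shA (K₂ + K))
      (fun K => shB (K₂ + K)) Wsh) :
    ∃ Wsh' : ℕ → ℝ, ShellWeightBound l₀ (fun K => T (M + K)) (fun K => A (M + K)) (fun K => B (M + K)) (fun K => shA (M + K))
      (fun K => shB (M + K)) Wsh' := by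
  obtain ⟨d, rfl⟩ := Nat.exists_eq_add_of_le hM
  exact ⟨fun K => Wsh (d + K), by simpa only [add_assoc] using shellWeightBound_shift d h⟩

/-- N19's ∃δ-edge conclusion delivered from origin `K₃` holds from every later origin `M ≥ K₃` (`core_shift`, `Summable.comp_injective`).
[bookkeeping] [folklore] -/
theorem coreSummable_reorigin [DecidableEq ι] {K₃ M : ℕ} (hM : K₃ ≤ M)
    (h : ∃ δ : ℕ → ℝ, NE7.Core l₀ vol (fun K => T (K₃ + K)) (fun K => Bad (K₃ + K)) (fun K t τ => A (K₃ + K) t τ - shA (K₃ + K) t τ)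
      (fun K t τ => B (K₃ + K) t τ - shB (K₃ + K) t τ) δ ∧ Summable δ) :
    ∃ δ : ℕ → ℝ, NE7.Core l₀ vol (fun K => T (M + K)) (fun K => Bad (M + K)) (fun K t τ => A (M + K) t τ - shA (M + K) t τ)
      (fun K t τ => B (M + K) t τ - shB (M + K) t τ) δ ∧ Summable δ := by
  obtain ⟨d, rfl⟩ := Nat.exists_eq_add_of_le hM
  obtain ⟨δ, hcore, hδ⟩ := h
  refine ⟨fun K => δ (d + K), ?_, hδ.comp_injective (add_right_injective d)⟩
  simpa only [add_assoc] using core_shift d hcore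

end Reorigin

section PerStringOrigins

variable {F : T4Family} {N : ℕ} [NeZero N]

/-- **`SpineDatum` FROM CHILDREN DELIVERED AT DIFFERENT ORIGINS.**  Carriers indexed from the dictionary's cutoff `K₀`
(`schemeZ … (K₀ + K) = Σ_{T K} A K`, `schemeZ … (K₀ + K + 1) = Σ_{T K} B K`); N20 delivered from relative origin `K₁` with its own weights, N21 from
`K₂` with its own shell weights, N19's ∃δ-edge from `K₃` — as the producers of record state them (`∃ K₁, RelWeightBound …` thresholds, log cuts,
ledger windows).  Then `YMDAG.UVSplit.SpineDatum D g₀ os`: re-index everything to any common origin `M ≥ K₁, K₂, K₃` (§1′ lemmas), re-associate the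
dictionary, and close by `spineDatum_of_tail` (the budget clause again derived, never asked).  No «reconciled origin» clause is needed in a spine
record. [bookkeeping] [folklore] -/
theorem spineDatum_of_origins (D : Datum F N) (g₀ : ℕ → ℝ) (os : List (ULoop F))
    {ι : Type} [DecidableEq ι] {l₀ vol : ℝ} (K₀ K₁ K₂ K₃ : ℕ) {T : ℕ → Finset ι} {A B shA shB : ℕ → ℝ → ι → ℝ}
    {Bad : ℕ → ℝ → Finset ι} {W Wsh : ℕ → ℝ}
    (hl₀ : 0 < l₀) (hvol : 0 < vol)
    (h20 : RelWeightBound l₀ (fun K => T (K₁ + K)) (fun K => A (K₁ + K)) (fun K => B (K₁ + K)) (fun K => Bad (K₁ + K)) W)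
    (h21 : ShellWeightBound l₀ (fun K => T (K₂ + K)) (fun K => A (K₂ + K)) (fun K => B (K₂ + K)) (fun K => shA (K₂ + K))
      (fun K => shB (K₂ + K)) Wsh)
    (h19 : ∃ δ : ℕ → ℝ, NE7.Core l₀ vol (fun K => T (K₃ + K)) (fun K => Bad (K₃ + K))
      (fun K t τ => A (K₃ + K) t τ - shA (K₃ + K) t τ) (fun K t τ => B (K₃ + K) t τ - shB (K₃ + K) t τ) δ ∧ Summable δ)
    (hE1 : ∀ (K : ℕ) (t : ℝ), |t| ≤ l₀ → T4GenFunBounds.schemeZ (D.scheme g₀) os (K₀ + K) t = ∑ τ ∈ T K, A K t τ)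
    (hE2 : ∀ (K : ℕ) (t : ℝ), |t| ≤ l₀ → T4GenFunBounds.schemeZ (D.scheme g₀) os (K₀ + K + 1) t = ∑ τ ∈ T K, B K t τ) :
    SpineDatum D g₀ os := by
  set M : ℕ := K₁ + K₂ + K₃ with hMdef
  obtain ⟨W', h20'⟩ := relWeightBound_reorigin (M := M) (by omega) h20
  obtain ⟨Wsh', h21'⟩ := shellWeightBound_reorigin (M := M) (by omega) h21
  obtain ⟨δ, hcore, hδ⟩ := coreSummable_reorigin (M := M) (by omega) h19
  refine spineDatum_of_tail D g₀ os (K₀ + M) hl₀ hvol h20' h21' hcore hδ (fun K t ht => ?_) (fun K t ht => ?_)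
  · have e : K₀ + M + K = K₀ + (M + K) := add_assoc _ _ _
    rw [e]
    exact hE1 (M + K) t ht
  · have e : K₀ + M + K = K₀ + (M + K) := add_assoc _ _ _
    rw [e]
    exact hE2 (M + K) t ht

end PerStringOrigins

/-! ## §2 Record level: K5 «SpineMatching» and B5 at the record from the stub signatures, `S_U4`'s budget half not asked -/

section Record

variable {N : ℕ} [NeZero N] (Rec : RecordPred N) (SRec : SpineRecordPred N) (Inputs : InputsPred N)

/-- **K5 JOIN WITHOUT THE BUDGET HALF OF U4′** (the route module's `SpineMatching_of` with `S_U4 SRec` weakened to its summability half):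
the expansion of record (N27x) with NE7b (N20), NE7c (N21) and the edge N19 at its carriers, the term-wise remainders being summable, IS,
given the in-edges, the spine datum — for all small-coupling tuned runs of every record pair and every loop string (`ForSmallCouplings.mono`,
`spineDatum_of_tail` per string; `letI := S.dec` as in `S_N19`). [bookkeeping] [folklore] -/
theorem spineMatching_of_stubs_tail (hx : S_N27x Rec SRec) (h20 : S_N20 SRec) (h21 : S_N21 SRec) (h19 : S_N19 SRec Inputs)
    (hδ : ∀ (F : T4Family) (D : Datum F N) (g₀ : ℕ → ℝ) (os : List (ULoop F)) (S : SpineCarriers),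
      SRec F D g₀ os S → Summable S.δ) :
    SpineMatching Rec Inputs := by
  intro F D w hR hB hEnd
  refine (hx F D w hR hB hEnd).mono fun g₀ hg os hin => ?_
  obtain ⟨S, hS, hl₀, hvol, hZA, hZB⟩ := hg os
  letI := S.dec
  exact spineDatum_of_tail D g₀ os S.K₀ hl₀ hvol (h20 F D g₀ os S hS) (h21 F D g₀ os S hS) (h19 F D g₀ os S hS hin)
    (hδ F D g₀ os S hS) hZA hZB

/-- **N27 = B5 AT THE RECORD FROM THE STUB SIGNATURES, THE BUDGET HALF OF U4′ NOT ASKED.**  For EVERY record predicate `Rec`, spine-carrier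
predicate `SRec` and inputs predicate `Inputs`: `S_N27x Rec SRec` (the expansion of record exists, E1∕E2), `S_N20 SRec` (NE7b), `S_N21 SRec`
(NE7c), `S_N19 SRec Inputs` (NE7's `Core` given the in-edges), `∀ …, SRec … S → Summable S.δ` and K4's hook `SpineRates Rec Inputs` give
`Spine Rec`, i.e. `T4ApexHybrid.HybridNE7Under D END` at every record pair: the two `ForSmallCouplings` conclusions are conjoined at the smaller
thresholds (`ForSmallCouplings.and`), modus ponens per string, and one string closes by file IX's `stringHybridNE7_of_spineNodes_tail`
(`∃ K₁, StringHybridNE7 … (S.K₀ + K₁)`, offset existential in B5's currency).  K4 IS CONSUMED HERE.  Independent of the joins part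
`BalabanUVNodesClusters` (= its `B5_at_record ∘ SpineMatching_of` with `S_U4` weakened). [bookkeeping] [folklore] -/
theorem spine_of_stubs_tail (hx : S_N27x Rec SRec) (h20 : S_N20 SRec) (h21 : S_N21 SRec) (h19 : S_N19 SRec Inputs)
    (hδ : ∀ (F : T4Family) (D : Datum F N) (g₀ : ℕ → ℝ) (os : List (ULoop F)) (S : SpineCarriers),
      SRec F D g₀ os S → Summable S.δ)
    (h4 : SpineRates Rec Inputs) : Spine Rec := by
  intro F D w hR
  show D.UnderHypotheses _ fun g₀ => T4ApexHybrid.StringwiseHybridNE7 (D.scheme g₀)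
  intro hB hEnd
  refine ((h4 F D w hR hB hEnd).and (hx F D w hR hB hEnd)).mono fun g₀ hg os => ?_
  obtain ⟨S, hS, hl₀, hvol, hZA, hZB⟩ := hg.2 os
  letI := S.dec
  obtain ⟨K₁, hK⟩ := stringHybridNE7_of_spineNodes_tail (D.scheme g₀) os S.K₀ (h20 F D g₀ os S hS) (h21 F D g₀ os S hS)
    ⟨S.δ, h19 F D g₀ os S hS (hg.1 os), hδ F D g₀ os S hS⟩ hZA hZB
  exact ⟨S.l₀, S.vol, S.K₀ + K₁, hl₀, hvol, hK⟩

/-! ## §2′ The rev-1 K5 shape stated today: N19 as the ∃δ-EDGE «`SRec` ∧ `Inputs` ⇒ ∃ δ, Core ∧ Summable δ» (δ NOT read from the carriers,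
U4′ not asked at all) — plan [YMPLAN-G62-WORD-N19-JUNCTION] (d), dagwriter [WORD-N19-JUNCTION], n19-a's `s_N19_of_coreEdge` input shape -/

/-- **K5 JOIN FROM THE ∃δ-EDGE, U4′ NOT ASKED.**  `S_N27x Rec SRec` · `S_N20 SRec` · `S_N21 SRec` · the N19 EDGE in the shape every landed N19 knit
produces — at the carriers of record, given K4's conclusion, SOME summable remainder `δ` carries `Spine.NE7.Core` on the shell-free cores (the carriers'
own field `S.δ` is not read) ⇒ `SpineMatching Rec Inputs`.  This is the plan's rev-1 design «K5 = N27x · N20 · N21 · N19′, U4′ retired» typed over the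
rev-0 decls of `BalabanUVNodesClustersCore`. [bookkeeping] [folklore] -/
theorem spineMatching_of_coreEdge (hx : S_N27x Rec SRec) (h20 : S_N20 SRec) (h21 : S_N21 SRec)
    (h19 : ∀ (F : T4Family) (D : Datum F N) (g₀ : ℕ → ℝ) (os : List (ULoop F)) (S : SpineCarriers),
      SRec F D g₀ os S → Inputs F D g₀ os → letI := S.dec
        ∃ δ : ℕ → ℝ, NE7.Core S.l₀ S.vol S.T S.Bad (fun K t τ => S.A K t τ - S.shA K t τ) (fun K t τ => S.B K t τ - S.shB K t τ) δ ∧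
          Summable δ) :
    SpineMatching Rec Inputs := by
  intro F D w hR hB hEnd
  refine (hx F D w hR hB hEnd).mono fun g₀ hg os hin => ?_
  obtain ⟨S, hS, hl₀, hvol, hZA, hZB⟩ := hg os
  letI := S.dec
  obtain ⟨δ, hcore, hδ⟩ := h19 F D g₀ os S hS hin
  exact spineDatum_of_tail D g₀ os S.K₀ hl₀ hvol (h20 F D g₀ os S hS) (h21 F D g₀ os S hS) hcore hδ hZA hZB

/-- **N27 = B5 AT THE RECORD FROM THE ∃δ-EDGE, U4′ NOT ASKED**: `S_N27x` · `S_N20` · `S_N21` · the N19 edge «`SRec` ∧ `Inputs` ⇒ ∃ δ, Core ∧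
Summable δ» · K4's hook `SpineRates Rec Inputs` ⇒ `Spine Rec` (`ForSmallCouplings.and`, modus ponens per string, file IX's
`stringHybridNE7_of_spineNodes_tail`).  K4 IS CONSUMED HERE.  The rev-1 join target in today's decls. [bookkeeping] [folklore] -/
theorem spine_of_coreEdge (hx : S_N27x Rec SRec) (h20 : S_N20 SRec) (h21 : S_N21 SRec)
    (h19 : ∀ (F : T4Family) (D : Datum F N) (g₀ : ℕ → ℝ) (os : List (ULoop F)) (S : SpineCarriers),
      SRec F D g₀ os S → Inputs F D g₀ os → letI := S.dec
        ∃ δ : ℕ → ℝ, NE7.Core S.l₀ S.vol S.T S.Bad (fun K t τ => S.A K t τ - S.shA K t τ) (fun K t τ => S.B K t τ - S.shB K t τ) δ ∧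
          Summable δ)
    (h4 : SpineRates Rec Inputs) : Spine Rec := by
  intro F D w hR
  show D.UnderHypotheses _ fun g₀ => T4ApexHybrid.StringwiseHybridNE7 (D.scheme g₀)
  intro hB hEnd
  refine ((h4 F D w hR hB hEnd).and (hx F D w hR hB hEnd)).mono fun g₀ hg os => ?_
  obtain ⟨S, hS, hl₀, hvol, hZA, hZB⟩ := hg.2 os
  letI := S.dec
  obtain ⟨K₁, hK⟩ := stringHybridNE7_of_spineNodes_tail (D.scheme g₀) os S.K₀ (h20 F D g₀ os S hS) (h21 F D g₀ os S hS)
    (h19 F D g₀ os S hS (hg.1 os)) hZA hZB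
  exact ⟨S.l₀, S.vol, S.K₀ + K₁, hl₀, hvol, hK⟩

/-! ## §3 Faithfulness at the record: the merged child «Spine» IS cluster K5 with K4's conclusion set to `True` -/

/-- **`Spine Rec ↔ SpineMatching Rec ⊤`** — binder B5 at the record (`T4ApexHybrid.HybridNE7Under D END` for every record pair) is
EQUIVALENT to cluster K5 «SpineMatching» with the inputs predicate `fun _ _ _ _ => True` (R420's unguarded K5
`ForSmallCouplings D (∀ os, SpineDatum D g₀ os)` under the pins): the composite node says nothing beyond N19 ∧ N20 ∧ N21 ∧ `Summable δ` ∧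
E1∕E2 at some carriers per string under the prefix, and nothing less (file X's `hybridNE7Under_iff_spineNodes_tail`, §1 `spineDatum_of_tail`;
`D.UnderHypotheses Hβ c` is `(B) → Hβ → ForSmallCouplings D c` definitionally, `ForSmallCouplings.of_underHypotheses`). [bookkeeping] [folklore] -/
theorem spine_iff_spineMatching_true : Spine Rec ↔ SpineMatching Rec (fun _ _ _ _ => True) := by
  refine ⟨fun h F D w hR hB hEnd => ?_, fun h F D w hR => ?_⟩
  · refine (ForSmallCouplings.of_underHypotheses ((hybridNE7Under_iff_spineNodes_tail D _).mp (h F D w hR)) hB hEnd).mono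
      fun g₀ hg os _ => ?_
    obtain ⟨ι, _, l₀, vol, K₀, T, A, B, shA, shB, Bad, W, Wsh, δ, hl₀, hvol, h20, h21, h19, hδ, hE1, hE2⟩ := hg os
    exact spineDatum_of_tail D g₀ os K₀ hl₀ hvol h20 h21 h19 hδ hE1 hE2
  · refine hybridNE7Under_of_spineNodes_tail D fun hB hEnd => (h F D w hR hB hEnd).mono fun g₀ hg os => ?_
    obtain ⟨ι, _, l₀, vol, K₀, T, A, B, shA, shB, Bad, W, Wsh, δ, hl₀, hvol, h20, h21, h19, -, hδ, hE1, hE2⟩ := hg os trivial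
    exact ⟨ι, ‹_›, l₀, vol, K₀, T, A, B, shA, shB, Bad, W, Wsh, δ, hl₀, hvol, h20, h21, h19, hδ, hE1, hE2⟩

end Record

end Summit.QuantumFields.YangMills.Theorems.BalabanUVNodesN27SpineRecord
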